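import Summits.Ventures.CertifiedManyBodySolver.Observables.PhaseSeparationExclusionParticleHole
import Summits.Ventures.CertifiedManyBodySolver.Observables.PhaseSeparationExclusionBoxZeemanTcap
import HarnessLib

/-!
# Ventures/CertifiedManyBodySolver — Observables/PhaseSeparationExclusionParticleHoleZeeman.lean: the particle–hole transport of the
# competing-order words, PART 3 — THE FIELD (`H`) AXIS: the `T = 0` Zeeman column law REFLECTED to the electron-doped side
# (densities `≥ 1`, where the field cost is `|h|·(2 − ρ)` — the SAME number as the hole-side image's `|h|·ρ`)

HONEST FRAMING: first certified bounds; not a superconductivity verdict. CLASS = TRANSPORT (generic, sorry-free; no claim node, no number, no definition).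
Companion of `PhaseSeparationExclusionParticleHole{,Columns}.lean` (g28). The tree's `T = 0` field law
`IsTranslationInvariant.fieldGroundEnergy_lt_meanEnergy_mix_of_cap_lt_floors_of_le` (`HubbardTTPrimePhaseCoexistenceExclusionZeeman`, this seat g21) is
stated for ALL densities with the field cost `|h|·(a·min(n₁, 2−n₁) + b·min(n₂, 2−n₂))`; only its column conveniences
(`psH_not_fieldGroundState_mix_on_cell_of_columns{,_tcap}`) are hole-doped (`n₂ ≤ 1`). Under `(t′, n) ↦ (−t′, 2 − n)` the zero-field cap / floors of a
hole-side cell transport with the affine terms of `energyDensityTT'_particleHole` (`reflected_cap`, `reflected_floor`), the zero-field margin is invariant,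
AND THE FIELD COST IS INVARIANT: for the mirrored pair `(2 − n₂, 2 − n₁)` with weights `(b, a)`, `b·min(2−n₂, n₂) + a·min(2−n₁, n₁) = a n₁ + b n₂` (`n₂ ≤ 1`).
Hence:
* `psH_not_fieldGroundState_mix_on_cell_of_columns_tcap_reflected` — hypotheses EXACTLY as `psH_not_fieldGroundState_mix_on_cell_of_columns_tcap`
  (source cell `[s₁, s₂] × [U₁, U₂]`, `0 ≤ U₁ < U₂`, `0 < n₁ < n₂ ≤ 1`; cap `c₀ + c_s s + c₁ U`; column laws at `n₂`; dilute floor `F₁(s)`; both column margins AFTER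
  the field cost `h₀·(an₁ + bn₂)` positive; `|h| ≤ h₀`), conclusion: at every `(s, U)` of the MIRRORED cell `[−s₂, −s₁] × [U₁, U₂]` no mixture of
  translation-invariant states with densities `0 < ρ(ω₁) ≤ 2 − n₂`, `2 − n₁ ≤ ρ(ω₂) < 2` is a ground state of `Φ(t,s,U) − h·(n↑ − n↓)` at its filling —
  the electron-doped box keeps the hole-side image's field threshold `h₀`.
Instances: `Observables/PhaseSeparationExclusionElectronDopedMirrorAxes.lean`. NOT done: the `T > 0` field form (no electron-doped instance yet), orbital
coupling of the field. Cell `pub/hubbard-downfold` (MO-S1 ↔ S2 seam, filling direction; D-0098/D-0100 `H` axis of the phase map), seat `hubbard-downfold-unc-2` (g28),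
2026-08-29. Zero kit. References: [cite: LiebWuPhysicaA2003, §1 eq. (3)]; [cite: Israel1979, Thm. I.2.4]; [cite: Griffiths1964, Appendix];
[cite: LiebPRL1989, proof of Theorem 1]; [cite: EmeryKivelsonLin1990, pp. 475–476].
-/

noncomputable section

namespace Summit.Ventures.CertifiedManyBodySolver.Observables

open Literature.MathematicalPhysics.QuantumLattice Literature.MathematicalPhysics.QuantumLattice.ThermodynamicLimit
open Literature.MathematicalPhysics.QuantumLattice.InfVolFermionState Set Filter

/-- **FIELD PS EXCLUSION ON THE MIRRORED CELL, `T = 0`, COLUMN FORM, CAP AFFINE IN `(s, U)`.** Hypotheses exactly as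
`psH_not_fieldGroundState_mix_on_cell_of_columns_tcap` with `0 < n₁` (source cell `[s₁, s₂] × [U₁, U₂]`, `0 ≤ U₁ < U₂`, densities `n₁ < n₂ ≤ 1`, zero-field cap
`c₀ + c_s s + c₁ U` at `an₁ + bn₂`, column laws `L_i(s) ≤ e(t,s,U_i,n₂)`, dilute floor `F₁(s)`, `|h| ≤ h₀`, positive column margins after the field cost
`h₀·(an₁ + bn₂)`). THEN for every `(s, U)` of the MIRRORED cell `[−s₂, −s₁] × [U₁, U₂]` no mixture `λω₁ + (1−λ)ω₂` (`0 < λ < 1`) of translation-invariant states with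
`0 < ρ(ω₁) ≤ 2 − n₂`, `2 − n₁ ≤ ρ(ω₂) < 2` is a ground state of `Φ(t,s,U) − h·(n↑ − n↓)` at its filling: the electron-doped pair carries the field cost
`|h|·(b·(2 − (2−n₂)) + a·(2 − (2−n₁))) = |h|·(an₁ + bn₂)`, the hole-side number. [cite: LiebWuPhysicaA2003, §1 eq. (3)] [cite: Israel1979, Thm. I.2.4] [cite: Griffiths1964, Appendix] -/
theorem psH_not_fieldGroundState_mix_on_cell_of_columns_tcap_reflected (t : ℝ) {s₁ s₂ U₁ U₂ n₁ n₂ a b c₀ cs c₁ h₀ hz : ℝ}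
    (hU₁ : 0 ≤ U₁) (h12 : U₁ < U₂) (hn₁ : 0 < n₁) (hn : n₁ < n₂) (hn₂ : n₂ ≤ 1) (ha : 0 ≤ a) (hb : 0 ≤ b) (hab : a + b = 1)
    {L₁ L₂ F₁ : ℝ → ℝ}
    (hC : ∀ s ∈ Icc s₁ s₂, ∀ U ∈ Icc U₁ U₂, energyDensityTT' t s U (a * n₁ + b * n₂) ≤ c₀ + cs * s + c₁ * U)
    (hL₁ : ∀ s ∈ Icc s₁ s₂, L₁ s ≤ energyDensityTT' t s U₁ n₂) (hL₂ : ∀ s ∈ Icc s₁ s₂, L₂ s ≤ energyDensityTT' t s U₂ n₂)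
    (hF₁ : ∀ s ∈ Icc s₁ s₂, ∀ U ∈ Icc U₁ U₂, F₁ s ≤ energyDensityTT' t s U n₁)
    (hh : |hz| ≤ h₀)
    (hm₁ : ∀ s ∈ Icc s₁ s₂, c₀ + cs * s + c₁ * U₁ + h₀ * (a * n₁ + b * n₂) < a * F₁ s + b * L₁ s)
    (hm₂ : ∀ s ∈ Icc s₁ s₂, c₀ + cs * s + c₁ * U₂ + h₀ * (a * n₁ + b * n₂) < a * F₁ s + b * L₂ s)
    {s : ℝ} (hs : s ∈ Icc (-s₂) (-s₁)) {U : ℝ} (hU : U ∈ Icc U₁ U₂)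
    {ω₁ ω₂ : InfVolFermionState 2} (h₁ : ω₁.IsTranslationInvariant) (h₂ : ω₂.IsTranslationInvariant)
    (hρ₁ : 0 < ω₁.density) (hρ₁' : ω₁.density ≤ 2 - n₂) (hρ₂ : 2 - n₁ ≤ ω₂.density) (hρ₂' : ω₂.density < 2)
    {lam : ℝ} (hl0 : 0 < lam) (hl1 : lam < 1) :
    (gcInteractionTT' t s U 0 hz).tiGroundEnergyDensityAt 1 (mix lam hl0.le hl1.le ω₁ ω₂).density <
      (mix lam hl0.le hl1.le ω₁ ω₂).meanEnergy (gcInteractionTT' t s U 0 hz) 1 := by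
  have hn2' : 0 ≤ n₂ := hn₁.le.trans hn.le
  have hn₂2 : n₂ < 2 := by linarith
  have hm0 : 0 < a * n₁ + b * n₂ := by nlinarith
  have hm2 : a * n₁ + b * n₂ < 2 := by nlinarith
  have hs' : -s ∈ Icc s₁ s₂ := neg_mem_Icc_of_mem_Icc_neg hs
  have hUU : 0 ≤ U := hU₁.trans hU.1
  -- the reflected zero-field bundle at the target point `(s, U)`
  have hcap : energyDensityTT' t s U (b * (2 - n₂) + a * (2 - n₁)) ≤
      c₀ + cs * (-s) + c₁ * U + U * (b * (2 - n₂) + a * (2 - n₁) - 1) :=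
    reflected_cap t hU₁ hab hm0 hm2 (C := fun s U => c₀ + cs * s + c₁ * U) hC s hs U hU
  have hfl₂ : ((U₂ - U) * L₁ (-s) + (U - U₁) * L₂ (-s)) / (U₂ - U₁) + U * (1 - n₂) ≤ energyDensityTT' t s U (2 - n₂) :=
    reflected_floor t hU₁ (hn₁.trans hn) hn₂2 (F := fun s U => ((U₂ - U) * L₁ s + (U - U₁) * L₂ s) / (U₂ - U₁))
      (floor_on_cell_of_columnLaws t hn2' hn₂2 hU₁ h12 hL₁ hL₂) s hs U hU
  have hfl₁ : F₁ (-s) + U * (1 - n₁) ≤ energyDensityTT' t s U (2 - n₁) :=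
    reflected_floor t hU₁ hn₁ (show n₁ < 2 by linarith) (F := fun s _ => F₁ s) hF₁ s hs U hU
  refine h₁.fieldGroundEnergy_lt_meanEnergy_mix_of_cap_lt_floors_of_le t s hUU hz h₂ hρ₁ hρ₂' hρ₁' (by linarith) hρ₂ hb ha
    (by linarith) hcap hfl₂ hfl₁ ?_ hl0 hl1
  -- the field cost of the mirrored pair is the hole-side number
  have e₁ : min (2 - n₂) (2 - (2 - n₂)) = n₂ := by rw [sub_sub_cancel]; exact min_eq_right (by linarith)
  have e₂ : min (2 - n₁) (2 - (2 - n₁)) = n₁ := by rw [sub_sub_cancel]; exact min_eq_right (by linarith)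
  rw [e₁, e₂]
  -- the source margin at `(-s, U)` beats the field cost (U-chord of the two column margins)
  have hpos := uchord_pos_of_ends h12 hU (sub_pos.2 (hm₁ (-s) hs')) (sub_pos.2 (hm₂ (-s) hs'))
  have hd : (U₂ - U₁) ≠ 0 := (sub_pos.2 h12).ne'
  have hid : a * F₁ (-s) + b * (((U₂ - U) * L₁ (-s) + (U - U₁) * L₂ (-s)) / (U₂ - U₁)) -
        (c₀ + cs * (-s) + c₁ * U + h₀ * (a * n₁ + b * n₂)) =
      ((U₂ - U) * (a * F₁ (-s) + b * L₁ (-s) - (c₀ + cs * (-s) + c₁ * U₁ + h₀ * (a * n₁ + b * n₂))) +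
        (U - U₁) * (a * F₁ (-s) + b * L₂ (-s) - (c₀ + cs * (-s) + c₁ * U₂ + h₀ * (a * n₁ + b * n₂)))) / (U₂ - U₁) := by
    field_simp
    ring
  have hsrc := hid ▸ hpos
  have hcost : |hz| * (b * n₂ + a * n₁) ≤ h₀ * (a * n₁ + b * n₂) := by
    have := mul_le_mul_of_nonneg_right hh hm0.le
    linarith [this]
  have hb1 : b = 1 - a := by linarith
  subst hb1
  linarith

end Summit.Ventures.CertifiedManyBodySolver.Observables

end
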